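import Summits.ABC.ABC.Theses.IsogenyGlueCongruence
import Literature.NumberTheory.EllipticCurves.HeightCovolumeBoundsProofs

/-!
# `PolyHeightOfBoundedPrimes` (stmt-ABC-16006, crux B') — the finite / archimedean split of the
consequent is EXACT, so the landed floors of the halves are floors of every split proof

Support bookkeeping (cdisprove seat `refuter-cdisprove-stmt-ABC-16006-0`, cycle 1, 2026-08-16).
Card `archimedean-hall-split` proves `PolySzpiroΔ → PolyHallΔ → H` (its Sketch) and leaves the
converse "to the crux-plan seat". Recorded here, from the tree theorem
`Literature.NumberTheory.EllipticCurves.conductorNorm_le_abs_Δ` (`N_W ≤ |Δ_W|` on a global minimal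
model: `N_E ∣ |Δ_min|`, Ogg–Saito):

* `split_of_polyHeight` — `H → PolySzpiroΔ ∧ PolyHallΔ` (exponents `σ`, `max σ 0`; constants `C`,
  `max C 0`). With the card's direction the split is an EQUIVALENCE, hence the floors
  `not_polySzpiroΔAt_of_le_six` (Δ-half, `σ > 6`), `not_polyHallAt_of_lt_three_halves` (Hall half,
  `σ' ≥ 3/2`; conjecturally `6`) and `not_polyC4At_of_lt_six` bind every proof of B' organised
  along the split.

No Theses statement is asserted (`H` is the consequent of the item, open).
-/

noncomputable section

-- `Summit.<Summit>.<Problem>`: for the single-conjunct summit `ABC` the duplicate `ABC.ABC` is mandated.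
set_option linter.dupNamespace false

open Summit.ABC.ABC.Theses.IsogenyGlueCongruence
open WeierstrassCurve IsDedekindDomain
open Literature.NumberTheory.EllipticCurves

namespace Summit.ABC.ABC.Theorems.PolyHeightOfBoundedPrimes.Negative

/-- **The split of the consequent is exact: `H → PolySzpiroΔ ∧ PolyHallΔ`.** From
`max(|Δ|, |c₄|³) ≤ C·N^σ`: the finite half with the same `(σ, C)`, and the Hall half
`|c₄|³ ≤ max(C,0)·|Δ|^{max(σ,0)}` because `1 ≤ N_W ≤ |Δ_W|`. (Converse: the card's
`polyHeightOfBoundedPrimes_of_split`, exponent `max(σ, σσ')`.) [folklore] -/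
theorem split_of_polyHeight
    (hH : ∃ σ C : ℝ, ∀ (W : WeierstrassCurve ℚ) [W.IsElliptic] [W.IsGloballyMinimal]
      [NeZero (W.conductorNorm ℤ)], W.IsSemistable ℤ →
        ((max |W.Δ| (|W.c₄| ^ 3) : ℚ) : ℝ) ≤ C * (W.conductorNorm ℤ : ℝ) ^ σ) :
    (∃ σ C : ℝ, ∀ (W : WeierstrassCurve ℚ) [W.IsElliptic] [W.IsGloballyMinimal]
      [NeZero (W.conductorNorm ℤ)], W.IsSemistable ℤ →
        ((|W.Δ| : ℚ) : ℝ) ≤ C * (W.conductorNorm ℤ : ℝ) ^ σ) ∧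
    (∃ σ C : ℝ, 0 ≤ σ ∧ ∀ (W : WeierstrassCurve ℚ) [W.IsElliptic] [W.IsGloballyMinimal]
      [NeZero (W.conductorNorm ℤ)], W.IsSemistable ℤ →
        ((|W.c₄| ^ 3 : ℚ) : ℝ) ≤ C * ((|W.Δ| : ℚ) : ℝ) ^ σ) := by
  obtain ⟨σ, C, h⟩ := hH
  refine ⟨⟨σ, C, fun W _ _ _ hW ↦ le_trans (by exact_mod_cast le_max_left _ _) (h W hW)⟩,
    ⟨max σ 0, max C 0, le_max_right _ _, fun W _ _ _ hW ↦ ?_⟩⟩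
  have hmax := h W hW
  have hc4 : ((|W.c₄| ^ 3 : ℚ) : ℝ) ≤ ((max |W.Δ| (|W.c₄| ^ 3) : ℚ) : ℝ) := by
    exact_mod_cast le_max_right _ _
  have hN1 : (1 : ℝ) ≤ (W.conductorNorm ℤ : ℝ) := Nat.one_le_cast.mpr (W.conductorNorm_pos_holds)
  have hN0 : (0 : ℝ) ≤ (W.conductorNorm ℤ : ℝ) := Nat.cast_nonneg _
  have hNσ : (0 : ℝ) ≤ (W.conductorNorm ℤ : ℝ) ^ σ := Real.rpow_nonneg hN0 σ
  have hNΔ : (W.conductorNorm ℤ : ℝ) ≤ ((|W.Δ| : ℚ) : ℝ) :=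
    Literature.NumberTheory.EllipticCurves.conductorNorm_le_abs_Δ W
  have hC0 : (0 : ℝ) ≤ max C 0 := le_max_right _ _
  calc ((|W.c₄| ^ 3 : ℚ) : ℝ) ≤ C * (W.conductorNorm ℤ : ℝ) ^ σ := hc4.trans hmax
    _ ≤ max C 0 * (W.conductorNorm ℤ : ℝ) ^ σ := mul_le_mul_of_nonneg_right (le_max_left _ _) hNσ
    _ ≤ max C 0 * (W.conductorNorm ℤ : ℝ) ^ (max σ 0) :=
        mul_le_mul_of_nonneg_left (Real.rpow_le_rpow_of_exponent_le hN1 (le_max_left _ _)) hC0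
    _ ≤ max C 0 * ((|W.Δ| : ℚ) : ℝ) ^ (max σ 0) :=
        mul_le_mul_of_nonneg_left (Real.rpow_le_rpow hN0 hNΔ (le_max_right _ _)) hC0

end Summit.ABC.ABC.Theorems.PolyHeightOfBoundedPrimes.Negative

end
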